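import Summits.ResolutionOfSingularities.ResolutionOfSingularities.Theorems.ValuativeLuAlphaPTorsorCurveMonomializationBookkeeping
import Summits.ResolutionOfSingularities.ResolutionOfSingularities.Theorems.ValuativeLuAlphaPTorsorCurveMonomializationEndgame
import Summits.ResolutionOfSingularities.ResolutionOfSingularities.Theorems.ValuativeLuAlphaPTorsorCurveMonomializationReduction
import Summits.ResolutionOfSingularities.ResolutionOfSingularities.Theorems.ValuativeLuAlphaPTorsorCurveMonomializationFollowed

/-!
# Monomialization of one element along the quadratic sequence of a two-dimensional regular
# local ring (embedded resolution of a plane curve germ along a valuation)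

Stub `stub_curveMonomialization` (B1) of the line `pfaff-line-log-final-forms` of the crux
`Valuative.LuAlphaPTorsor` (item `stmt-ResolutionOfSingularities-0641`), PROVED: let `R₀` be a
two-dimensional regular local ring of the field `K` (`Frac R₀ = K`), `O` a valuation ring of `K`
dominating it, `R₀ → R₁ → ⋯` the sequence of quadratic transforms along `O`, and suppose the
one-dimensional prime quotients of `R₀` have finite normalisation. Then every `0 ≠ b ∈ R_{i₀}`
is, in some later `Rᵢ`, a unit times a monomial in a regular system of parameters.

Proof (Zariski; Abhyankar 1956; characteristic free). If some member of the sequence is a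
discrete valuation ring the sequence is stationary at `O` and `b = ϖⁿ · unit`
(`monomial_of_mem_or_inv_mem`). Otherwise all `Rᵢ` are two-dimensional regular
(`IsQuadraticTransform.mem_or_inv_mem_or_isRegularLocalRing`) and the prime divisors of `b` on
`Spec Rᵢ` are the valuation rings `W ⊇ Rᵢ` with `w(b) > 0` not dominating `Rᵢ`
(`…CurveMonomializationDivisors`); a divisor of `b` on `Spec R_{i+1}` is one on `Spec Rᵢ` or
dominates `Rᵢ` (is exceptional). At most one divisor contains `O`, and it becomes regular at the
centre (`exists_base`: exceptional ones are regular at birth, `exists_regular_parameter_of_dominates`;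
a non-exceptional one is followed for ever and Herrmann–Ikeda–Orbanz (30.2) applies,
`exists_regular_parameter_of_followed` + `isQuadraticTransformAlong_residue`); from that stage
on, the divisors through the centre other than finitely many old ones `F` (none containing `O`)
are cut out by members of one regular system of parameters (`good_iterate`), the members of `F`
disappear after finitely many steps by Abhyankar's union lemma (`exists_forall_not_le`), and then
`b` is a unit times a monomial (`monomial_of_good`).
[cite: Abhyankar1956Valuations, Lemma 12] [cite: HerrmannIkedaOrbanz1988, Thm. (30.2) (proof)]
-/

set_option linter.dupNamespace false

namespace Summit.ResolutionOfSingularities.ResolutionOfSingularities.Theorems.PfaffLine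

open IsLocalRing Literature.AlgebraicGeometry.Resolution

namespace CurveMono

variable {K : Type} [Field K]

/-- **The base stage.** Along the quadratic sequence (all members two-dimensional regular) of
`R₀` along `O`, for `0 ≠ b ∈ R_{i₀}` there are a stage `i₂ ≥ i₀` and a regular system of
parameters `(u, v)` of `R_{i₂}` such that every divisor `W ⊇ O` of `b` on `Spec R_{i₂}` has
`w(u) > 0` or `w(v) > 0`: if some divisor `W₀ ⊇ O` of `b` exists at a stage `≥ i₀`, it becomes
regular — at birth if exceptional (`exists_regular_parameter_of_dominates`), by
Herrmann–Ikeda–Orbanz otherwise (`exists_regular_parameter_of_followed`) — stays regular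
(`propagate`), and every divisor `W ⊇ O` of `b` has `𝔪_{W₀} ⊆ 𝔪_W`
(`valuation_lt_one_of_followed`). [folklore] -/
theorem exists_base {O : ValuationSubring K} {R : ℕ → Subring K}
    (hreg : ∀ i, IsRegularLocalRing (R i)) (hdim : ∀ i, ringKrullDim (R i) = 2)
    (hof : IsLocalRingOf (R 0)) (h0 : SubringDominates (R 0) O.toSubring)
    (hstep : ∀ i, IsQuadraticTransformAlong O (R i) (R (i + 1)))
    (hfin : ∀ (𝔮 : Ideal (R 0)) (L : Type) [Field L] [Algebra (R 0 ⧸ 𝔮) L]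
      [IsFractionRing (R 0 ⧸ 𝔮) L], 𝔮.IsPrime → ringKrullDim (R 0 ⧸ 𝔮) = 1 →
        Module.Finite (R 0 ⧸ 𝔮) (integralClosure (R 0 ⧸ 𝔮) L))
    (i₀ : ℕ) {b : K} (hbR : b ∈ R i₀) (hb0 : b ≠ 0) :
    ∃ i₂, i₀ ≤ i₂ ∧ ∃ u v : R i₂, maximalIdeal (R i₂) = Ideal.span {u, v} ∧
      ∀ W : ValuationSubring K, R i₂ ≤ W.toSubring → W.valuation b < 1 →
        ¬ SubringDominates (R i₂) W.toSubring → O ≤ W →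
          W.valuation (u : K) < 1 ∨ W.valuation (v : K) < 1 := by
  classical
  haveI := hreg
  have hmono : Monotone R := sequence_monotone hstep
  have hdomO : ∀ i, SubringDominates (R i) O.toSubring := fun i => (sequence_dominates h0 hstep i).1
  have hofi : ∀ i, IsLocalRingOf (R i) := fun i => isLocalRingOf_of_le hof (hmono (Nat.zero_le i))
  have hRO : ∀ i, R i ≤ O.toSubring := fun i => (hdomO i).1
  by_cases hex : ∃ i, i₀ ≤ i ∧ ∃ W : ValuationSubring K, R i ≤ W.toSubring ∧
      W.valuation b < 1 ∧ ¬ SubringDominates (R i) W.toSubring ∧ O ≤ W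
  · obtain ⟨i, hi, W₀, -, hbW₀, hnd₀, hOW₀⟩ := hex
    have hRWall : ∀ j, R j ≤ W₀.toSubring := fun j x hx => hOW₀ (hRO j hx)
    have htop : W₀ ≠ ⊤ := by
      rintro rfl
      rcases (valuation_lt_one_iff_or ⊤ b).mp hbW₀ with h | h
      · exact hb0 h
      · exact h (ValuationSubring.mem_top _)
    -- a stage `c` at which the branch of `W₀` is regular
    obtain ⟨c, hndc, q, hq, hq2⟩ : ∃ c, ¬ SubringDominates (R c) W₀.toSubring ∧
        ∃ q : R c, W₀.valuation (q : K) < 1 ∧ q ∉ maximalIdeal (R c) ^ 2 := by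
      by_cases hd0 : SubringDominates (R 0) W₀.toSubring
      · -- `W₀` is exceptional: the last dominated stage `k`
        have hP : ∃ k, ¬ SubringDominates (R k) W₀.toSubring := ⟨i, hnd₀⟩
        obtain ⟨k₁, hk₁, hmin⟩ : ∃ k₁, ¬ SubringDominates (R k₁) W₀.toSubring ∧
            ∀ k < k₁, SubringDominates (R k) W₀.toSubring :=
          ⟨Nat.find hP, Nat.find_spec hP, fun k hk => by
            by_contra h; exact Nat.find_min hP hk h⟩
        have hk₁0 : k₁ ≠ 0 := by rintro rfl; exact hk₁ hd0
        obtain ⟨k, rfl⟩ := Nat.exists_eq_succ_of_ne_zero hk₁0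
        exact ⟨k + 1, hk₁, exists_regular_parameter_of_dominates (hdim k) (hdim (k + 1))
          (hdomO k) (hstep k) (hmin k (Nat.lt_succ_self k))⟩
      · -- `W₀` is followed for ever from `R 0`: Herrmann–Ikeda–Orbanz
        obtain ⟨c, q, hq, hq2⟩ := exists_regular_parameter_of_followed hreg hdim hof h0 hstep
          hfin hOW₀ htop hd0 (fun O'' hO'' j => isQuadraticTransformAlong_residue hOW₀ hO''
            (hstep j) (not_dominates_of_dominates (sequence_dominates h0 hstep j).2 hd0))
        exact ⟨c, not_dominates_of_dominates (sequence_dominates h0 hstep c).2 hd0, q, hq, hq2⟩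
    -- it stays regular
    have hprop : ∀ n, ¬ SubringDominates (R (c + n)) W₀.toSubring ∧
        ∃ q : R (c + n), W₀.valuation (q : K) < 1 ∧ q ∉ maximalIdeal (R (c + n)) ^ 2 := by
      intro n
      induction n with
      | zero => exact ⟨hndc, q, hq, hq2⟩
      | succ n ih =>
        obtain ⟨hndn, qn, hqn, hqn2⟩ := ih
        exact ⟨not_dominates_of_dominates ((hstep (c + n)).isQuadraticTransform
          (hdomO (c + n))).dominates hndn, propagate (hdim (c + n)) (hdim (c + n + 1))
            (hdomO (c + n)) (hstep (c + n)) (hRWall _) hndn hqn hqn2⟩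
    -- the stage `i₂ = max c i ≥ i₀`
    obtain ⟨hnd₂, q₂, hq₂, hq₂2⟩ := hprop (i - c)
    have hii₂ : i ≤ c + (i - c) := by omega
    have hq₂m : q₂ ∈ maximalIdeal (R (c + (i - c))) := by
      rw [mem_maximalIdeal_iff_inv_not_mem]
      exact ((valuation_lt_one_iff_or W₀ _).mp hq₂).imp_right fun h' hR => h' (hRWall _ hR)
    obtain ⟨v, huv, -, -⟩ := exists_maximalIdeal_eq_span_pair_of_not_mem_sq (hdim _) hq₂m hq₂2
    refine ⟨c + (i - c), hi.trans hii₂, q₂, v, huv, fun W _ hbW _ hOW => Or.inl ?_⟩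
    exact valuation_lt_one_of_followed (hdim _) (hofi _) (hRWall _) hnd₂
      (hmono (hi.trans hii₂) hbR) hb0 hbW₀ hOW₀ hOW hbW hq₂
  · push Not at hex
    obtain ⟨u, v, huv, -⟩ := exists_maximalIdeal_eq_span_pair (hdim i₀)
    exact ⟨i₀, le_rfl, u, v, huv, fun W hRW hbW hnd hOW => absurd hOW (hex i₀ le_rfl W hRW hbW hnd)⟩

end CurveMono

open CurveMono in
/-- Stub B1 of the line `pfaff-line-log-final-forms`: **monomialization of one element along the
quadratic sequence of a two-dimensional regular local ring along a valuation** (embedded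
resolution of a plane curve germ along a valuation; characteristic free). For `R₀` a
two-dimensional regular local ring of `K'`, `O'` a valuation ring of `K'` dominating it,
`R₀ → R₁ → ⋯` the quadratic transforms along `O'`, and granted that the one-dimensional prime
quotients of `R₀` have finite normalisation: every `0 ≠ b ∈ R_{i₀}` is, in some `Rᵢ` (`i ≥ i₀`),
a unit times a monomial in a regular system of parameters `u` of `Rᵢ` (`d = dim Rᵢ`).
[cite: Abhyankar1956Valuations, Lemma 12] [cite: HerrmannIkedaOrbanz1988, Thm. (30.2) (proof)] -/
theorem stub_curveMonomialization :
    ∀ (K' : Type) [Field K'] (O' : ValuationSubring K') (R : ℕ → Subring K'), IsRegularLocalRing (R 0) → ringKrullDim (R 0) = 2 → Literature.AlgebraicGeometry.Resolution.IsLocalRingOf (R 0) → Literature.AlgebraicGeometry.Resolution.SubringDominates (R 0) O'.toSubring → (∀ i, Literature.AlgebraicGeometry.Resolution.IsQuadraticTransformAlong O' (R i) (R (i + 1))) → (∀ (𝔮 : Ideal (R 0)) (L : Type) [Field L] [Algebra (R 0 ⧸ 𝔮) L] [IsFractionRing (R 0 ⧸ 𝔮) L], 𝔮.IsPrime → ringKrullDim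 (R 0 ⧸ 𝔮) = 1 → Module.Finite (R 0 ⧸ 𝔮) (integralClosure (R 0 ⧸ 𝔮) L)) → ∀ (i₀ : ℕ) (b : K'), b ∈ R i₀ → b ≠ 0 → ∃ i : ℕ, i₀ ≤ i ∧ ∃ (d : ℕ) (u : Fin d → R i) (M : Fin d → ℕ) (w : R i), IsUnit w ∧ (∀ z : R i, z ∈ Ideal.span (Set.range u) ↔ ¬ IsUnit z) ∧ ringKrullDim (R i) = (d : WithBot ℕ∞) ∧ b = (Finset.univ.prod fun j => ((u j : R i) : K') ^ M j) * ((w : R i) : K') := by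
  intro K _ O R hreg0 hdim0 hof0 h0 hstep hfin i₀ b hbR hb0
  classical
  have hregi : ∀ i, IsRegularLocalRing (R i) := isRegularLocalRing_sequence hreg0 hstep
  haveI := hregi
  have hmono : Monotone R := sequence_monotone hstep
  have hdomO : ∀ i, SubringDominates (R i) O.toSubring := fun i => (sequence_dominates h0 hstep i).1
  have hofi : ∀ i, IsLocalRingOf (R i) := fun i => isLocalRingOf_of_le hof0 (hmono (Nat.zero_le i))
  by_cases hall : ∀ i, ringKrullDim (R i) = 2
  · -- all members are two-dimensional regular local rings
    obtain ⟨i₂, hi₂, u, v, huv, hfollow⟩ := exists_base hregi hall hof0 h0 hstep hfin i₀ hbR hb0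
    set F : Set (ValuationSubring K) := {W | R i₂ ≤ W.toSubring ∧ W.valuation b < 1 ∧
      ¬ SubringDominates (R i₂) W.toSubring ∧
        ¬ (W.valuation (u : K) < 1 ∨ W.valuation (v : K) < 1)} with hF
    have hFfin : F.Finite := (finite_divisors (hall i₂) (hofi i₂) (hmono hi₂ hbR) hb0).subset
      fun W hW => ⟨hW.1, hW.2.1, hW.2.2.1⟩
    have hFO : ∀ W ∈ F, ¬ O ≤ W := fun W hW hOW =>
      hW.2.2.2 (hfollow W hW.1 hW.2.1 hW.2.2.1 hOW)
    have hgood : ∀ W : ValuationSubring K, R i₂ ≤ W.toSubring → W.valuation b < 1 →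
        ¬ SubringDominates (R i₂) W.toSubring →
          W ∈ F ∨ W.valuation (u : K) < 1 ∨ W.valuation (v : K) < 1 := by
      intro W h1 h2 h3
      by_cases h : W.valuation (u : K) < 1 ∨ W.valuation (v : K) < 1
      · exact Or.inr h
      · exact Or.inl ⟨h1, h2, h3, h⟩
    obtain ⟨j, hj⟩ := exists_forall_not_le hreg0 hdim0 hof0 h0 hstep hFfin hFO
    obtain ⟨u', v', huv', hgood'⟩ := good_iterate hregi hall h0 hstep F b i₂ huv hgood j
    have hV : ∀ W : ValuationSubring K, R (i₂ + j) ≤ W.toSubring → W.valuation b < 1 →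
        ¬ SubringDominates (R (i₂ + j)) W.toSubring →
          W.valuation (u' : K) < 1 ∨ W.valuation (v' : K) < 1 :=
      fun W h1 h2 h3 => (hgood' W h1 h2 h3).resolve_left fun hWF =>
        hj W hWF (i₂ + j) (Nat.le_add_left j i₂) h1
    obtain ⟨d, x, M, w, hw, hspan, hdimd, hb⟩ := monomial_of_good (hall (i₂ + j)) (hofi (i₂ + j))
      (hmono (hi₂.trans (Nat.le_add_right i₂ j)) hbR) hb0 huv' hV
    exact ⟨i₂ + j, hi₂.trans (Nat.le_add_right i₂ j), d, x, M, w, hw, hspan, hdimd, hb⟩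
  · -- some member is a discrete valuation ring of `K`: the sequence is stationary at `O`
    push Not at hall
    obtain ⟨m₁, hm₁, hmin⟩ : ∃ m₁, ringKrullDim (R m₁) ≠ 2 ∧ ∀ k < m₁, ringKrullDim (R k) = 2 :=
      ⟨Nat.find hall, Nat.find_spec hall, fun k hk => by
        by_contra h; exact Nat.find_min hall hk h⟩
    have hm₁0 : m₁ ≠ 0 := by rintro rfl; exact hm₁ hdim0
    obtain ⟨m, rfl⟩ := Nat.exists_eq_succ_of_ne_zero hm₁0
    have hdm : ringKrullDim (R m) = 2 := hmin m (Nat.lt_succ_self m)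
    have hqt : IsQuadraticTransform (R m) (R (m + 1)) :=
      (hstep m).isQuadraticTransform (hdomO m)
    have hval : ∀ z : K, z ∈ R (m + 1) ∨ z⁻¹ ∈ R (m + 1) := by
      rcases hqt.mem_or_inv_mem_or_isRegularLocalRing hdm (hofi m) with h | h
      · exact h
      · exact absurd h.2 hm₁
    have heq : R (m + 1) = O.toSubring := eq_of_mem_or_inv_mem (hdomO (m + 1)) hval
    -- at the stage `i = max (m + 1) i₀`, `R i = O`
    have hRi : R (max (m + 1) i₀) = O.toSubring :=
      le_antisymm (hdomO _).1 (heq ▸ hmono (le_max_left _ _))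
    have hvali : ∀ z : K, z ∈ R (max (m + 1) i₀) ∨ z⁻¹ ∈ R (max (m + 1) i₀) := by
      rw [hRi]; exact O.mem_or_inv_mem
    obtain ⟨x, hx, hx0, hxinv, -⟩ := exists_generator_of_step hstep (max (m + 1) i₀)
    obtain ⟨d, u, M, w, hw, hspan, hdimd, hb⟩ := monomial_of_mem_or_inv_mem hvali hx hx0 hxinv
      (hmono (le_max_right _ _) hbR) hb0
    exact ⟨max (m + 1) i₀, le_max_right _ _, d, u, M, w, hw, hspan, hdimd, hb⟩

end Summit.ResolutionOfSingularities.ResolutionOfSingularities.Theorems.PfaffLine
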